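import Summits.Ventures.CertifiedManyBodySolver.Certificates.HubbardSquare_n1_U8_stiffness_control
import Summits.Ventures.CertifiedManyBodySolver.Certificates.HubbardSquare_n7o8_upper_dbt299pair_row354
import Summits.Ventures.CertifiedManyBodySolver.Observables.RungLeavesStiffnessAnchor
import Literature.MathematicalPhysics.QuantumLattice.HubbardEnergyDensityHalfFillingMinimum
import Literature.MathematicalPhysics.QuantumLattice.HubbardEnergyDensityChordBounds
import HarnessLib
import HarnessLib.Audit

/-!
# Ventures/CertifiedManyBodySolver — Certificates/HubbardSquare_n1seg_U8ray_tp0_stiffness_chord_r472_r354_r488.lean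

HONEST FRAMING: one-sided certified CEILINGS on the uniform flux stiffness on a FILLING SEGMENT around the half-filled Mott line
(`t′ = 0` CONTROL face; print says `ρ_s = 0` at `n = 1` — a ceiling is silent on zero), by the `U`-chord / f-sum route from THREE ENERGY
claim nodes of record BY NAME (#472 cap at (8, 1, 0), #354 cap at (8, 7/8, 0), #488 floor at (6, 1, 0)); zero observable compute, zero new
solve; not a stiffness floor; not informative vs print; not a superconductivity or `T_c` verdict; no phase sentence.

Cell `pub/hubbard-downfold` (MO-S1 ↔ S2 seam; D-0150 line L-DF2 «box ↦ one word», FILLING leg), seat hubbard-downfold-unc-2,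
`prover-hubbard-downfold-unc-2-g12-0`. WHY: an S1 box carries a filling INTERVAL (the La₂CuO₄ parent's screening n-bar is `[0.99, 1.01]`,
`Downfold/BoxesLa214V110.lean`); the certified stiffness ceilings of record at the Mott control are POINT words at `n = 1`
(`n1_U8_tp0_stiffnessSeqLeaf_chord_r472_r488`: `0.3132401`; K3 `0.2126216`). This file shows the filling leg closing WITH NUMBERS from nodes
already in the tree — the energy data are moved along the density by the tree's convexity / particle–hole theorems, the kinetic ceiling by the
sharp `U`-chord, the coupling by Griffiths' `U`-ray:

* §1 `torusLimit_negKinetic_le_uchord_real` — the sharp `U`-chord kinetic ceiling of `Observables/StiffnessChordLeaf.lean` with REAL cap / floor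
  slots (the density-transported caps and floors below are real affine functions of `x`, not rational literals);
* §2 ENERGY TRANSPORT AROUND HALF FILLING (`t′ = 0`, any `U ≥ 0`): the particle–hole TANGENT floor `e(U, 1) + (U/2)(x − 1) ≤ e(U, x)`
  (`energyDensity2D_ge_at_one_add`, Lieb–Wu `μ₊ + μ₋ = U`); the density-CHORD cap below half filling from caps at `n_h < 1` and at `1`
  (`energyDensityTT'_le_density_chord`, Ruelle convexity); its particle–hole image above half filling (`energyDensity2D_particleHole`);
* §3 `n1seg_U8_tp0_negKinetic_le_of_r472_r354_r488` — for EVERY density `x ∈ [99/100, 101/100]` and every torus limit `ω` of unit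
  `(rectN x L, S^z = 0)`-sector ground states of `hubbardTorusTT' L 1 0 8`: `−k(ω) ≤ X₁ = 2504062787644156695299227/1888946593147858085478400
  ≈ 1.3256398` (the bound `3·cap(8, x) − 4·floor(6, x)` is affine on each half of the segment and particle–hole symmetric, so its worst value
  sits at the two ends; at `x = 1` it is the control's `1.2529600`); `…_seg2_…`: on `[49/50, 51/50]`, `X₂ ≈ 1.3983196`;
* §4 **`n1seg_U8ray_tp0_stiffnessSeqLeaf_of_r472_r354_r488`: for every `U ≥ 8` and every `x ∈ [0.99, 1.01]`,
  `ObsStiffnessSeqCeilingAt 0 U x 0.33141`** (tree units; HVR `D_s ≤ 0.165705`; vs `0.3132401` at the point `(8, 1, 0)` and the premise-free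
  kinematic `0.4052848`); `…_seg2_…`: `0.3495799` on `U ≥ 8 × [0.98, 1.02]` — the Griffiths `U`-ray
  (`ObsStiffnessSeqCeilingAt_tp0_on_ray_of_forall_negKinetic_le`) applied to §3 at every density of the segment.
CONDITIONAL only on the three claim nodes BY NAME. The La₂CuO₄ object-E box itself has `t′/t ∈ [−0.3, −0.2]`; this is its `t′ = 0` control face
(the f-sum word at `t′ ≠ 0` carries the diagonal term — hubbard-obs RULING (xx) d294 (B) L3/L4).

References: T. Koma, H. Tasaki, J. Stat. Phys. 76 (1994) 745, §1 [KomaTasaki1994]; E. H. Lieb, F. Y. Wu, Physica A 321 (2003) 1, §7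
[LiebWuPhysicaA2003]; D. Ruelle, Statistical Mechanics (1969) §3.3 [Ruelle1969]; R. B. Griffiths, J. Math. Phys. 7 (1966) 1215 §II
[Griffiths1966]; D. J. Scalapino, S. R. White, S.-C. Zhang, PRB 47 (1993) 7995, §II [ScalapinoWhiteZhang1993].
-/

noncomputable section

namespace Summit.Ventures.CertifiedManyBodySolver.Certificates

open Literature.MathematicalPhysics.QuantumLattice
open Literature.MathematicalPhysics.QuantumLattice.ThermodynamicLimit
open Literature.Probability.LatticeModels
open Summit.Ventures.CertifiedManyBodySolver.Observables
open Matrix Finset Filter Topology HubbardWave0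
open scoped Matrix BigOperators ComplexOrder

/-! ## §1 The sharp `U`-chord kinetic ceiling with real slots -/

/-- **Sharp `U`-chord kinetic CEILING, real slots** (`0 ≤ U₁ < U`, `0 ≤ n < 2`, `t′ = 0`): a cap `e(1,0,U,n) ≤ hi` and a floor `lo₁ ≤ e(1,0,U₁,n)`
(any reals) give `−k(ω) ≤ (U₁·hi − U·lo₁)/(U − U₁)` for every torus limit `ω` of unit `(rectN n L, S^z = 0)`-sector ground states of
`hubbardTorusTT' L 1 0 U` — the proof of `torusLimit_negKinetic_le_uchord` verbatim (`−k = U·D − e₀`, the docc `U`-chord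
`IsTorusLimitOf.re_expect_docc_le_chord_of_groundState` taken with the cap `u := e₀`). [cite: KomaTasaki1994, §1] -/
theorem torusLimit_negKinetic_le_uchord_real {U U₁ n : ℝ} (hU₁ : 0 ≤ U₁) (hlt : U₁ < U) (hn0 : 0 ≤ n) (hn2 : n < 2) {hi lo₁ : ℝ}
    (hcap : energyDensityTT' 1 0 U n ≤ hi) (hfloor : lo₁ ≤ energyDensityTT' 1 0 U₁ n) :
    ∀ (ω : InfVolFermionState 2) (Ls : ℕ → ℕ) (ψ : ∀ L, Fock (Orb (FermionTorus 2 L))),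
      Tendsto Ls atTop atTop →
      (∀ j, IsGroundStateInSector (hubbardTorusTT' (Ls j) 1 0 U) (rectN n (Ls j)) 0 (ψ (Ls j))) →
      (∀ j, star (ψ (Ls j)) ⬝ᵥ ψ (Ls j) = 1) → ω.IsTorusLimitOf ψ Ls →
      -(∑ i : Fin 2, -(1 : ℝ) * ∑ σ : Fin 2,
          ((ω.expect {0, 0 + unitVec i}
              ((cAt 0 (mem_insert_self _ _) σ)ᴴ * cAt (0 + unitVec i) (mem_insert_of_mem (mem_singleton_self _)) σ)).re +
            (ω.expect {0, 0 + unitVec i}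
              ((cAt (0 + unitVec i) (mem_insert_of_mem (mem_singleton_self _)) σ)ᴴ * cAt 0 (mem_insert_self _ _) σ)).re)) ≤
        (U₁ * hi - U * lo₁) / (U - U₁) := by
  intro ω Ls ψ hLs hψ h1 hω
  have hU : 0 ≤ U := hU₁.trans hlt.le
  have hd : 0 < U - U₁ := sub_pos.2 hlt
  rw [torusLimit_kineticDensity_eq_energy_sub_docc hU hn0 hn2 ω Ls ψ hLs hψ h1 hω]
  have hdocc : (ω.expect ({0} : Finset (Site 2)) (doccAt0 2)).re =
      (ω.expect {0} (nAt 0 (mem_singleton_self 0) 0 * nAt 0 (mem_singleton_self 0) 1)).re := rfl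
  have hch := hω.re_expect_docc_le_chord_of_groundState 1 0 hU hn0 hn2 hLs hψ h1 (le_refl (energyDensityTT' 1 0 U n))
    hU₁ hlt hfloor
  rw [← hdocc, le_div_iff₀ hd] at hch
  rw [le_div_iff₀ hd]
  have hU₁e : U₁ * energyDensityTT' 1 0 U n ≤ U₁ * hi := mul_le_mul_of_nonneg_left hcap hU₁
  nlinarith [hch, hU₁e, hU]

/-! ## §2 Energy transport around half filling (`t′ = 0`, any `U ≥ 0`) -/

/-- **Particle–hole TANGENT floor at half filling**: `e(1,0,U,1) + (U/2)(x − 1) ≤ e(1,0,U,x)` for `0 < x < 2` (`μ₋ ≤ U/2 ≤ μ₊`, Lieb–Wu; the line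
of slope `U/2` through the half-filling value supports the convex function `e(·)` on both sides). [cite: LiebWuPhysicaA2003, §7] -/
theorem energyDensityTT'_tp0_ge_halfFilling_tangent {U : ℝ} (hU : 0 ≤ U) {x : ℝ} (hx0 : 0 < x) (hx2 : x < 2) :
    energyDensityTT' 1 0 U 1 + U / 2 * (x - 1) ≤ energyDensityTT' 1 0 U x := by
  rw [energyDensityTT'_zero, energyDensityTT'_zero]
  exact energyDensity2D_ge_at_one_add 1 hU hx0 hx2

/-- **Density-CHORD cap below half filling**: caps `e(1,0,U,n_h) ≤ u_h` (`0 ≤ n_h < 1`) and `e(1,0,U,1) ≤ u₁` give, for `n_h < x ≤ 1`,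
`e(1,0,U,x) ≤ ((1 − x)·u_h + (x − n_h)·u₁)/(1 − n_h)` (convexity of `e` in the density). [cite: Ruelle1969, §3.3] -/
theorem energyDensityTT'_tp0_le_chord_below_one {U : ℝ} (hU : 0 ≤ U) {nh uh u₁ x : ℝ} (hnh : 0 ≤ nh)
    (huh : energyDensityTT' 1 0 U nh ≤ uh) (hu₁ : energyDensityTT' 1 0 U 1 ≤ u₁) (hx1 : nh < x) (hx2 : x ≤ 1) :
    energyDensityTT' 1 0 U x ≤ ((1 - x) * uh + (x - nh) * u₁) / (1 - nh) := by
  have hnh1 : nh < 1 := lt_of_lt_of_le hx1 hx2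
  rcases eq_or_lt_of_le hx2 with rfl | hx2'
  · have hd : (1 : ℝ) - nh ≠ 0 := sub_ne_zero.2 (ne_of_gt hnh1)
    rw [show ((1 - 1) * uh + (1 - nh) * u₁) / (1 - nh) = u₁ by field_simp; ring]
    exact hu₁
  · exact energyDensityTT'_le_density_chord 1 0 hU hnh hx1 hx2' (by norm_num) huh hu₁

/-- **Its particle–hole image above half filling**: with the same two caps, for `1 ≤ x < 2 − n_h`,
`e(1,0,U,x) ≤ ((x − 1)·u_h + (2 − n_h − x)·u₁)/(1 − n_h) + U·(x − 1)` (`e(x) = e(2 − x) + U(x − 1)`, Lieb–Wu §1 eq. (3), then the chord at `2 − x`).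
[cite: LiebWuPhysicaA2003, §1 eq. (3)] -/
theorem energyDensityTT'_tp0_le_chord_above_one {U : ℝ} (hU : 0 ≤ U) {nh uh u₁ x : ℝ} (hnh : 0 ≤ nh)
    (huh : energyDensityTT' 1 0 U nh ≤ uh) (hu₁ : energyDensityTT' 1 0 U 1 ≤ u₁) (hx1 : 1 ≤ x) (hx2 : x < 2 - nh) :
    energyDensityTT' 1 0 U x ≤ ((x - 1) * uh + (2 - nh - x) * u₁) / (1 - nh) + U * (x - 1) := by
  have hx0 : 0 < x := by linarith
  have hx2' : x < 2 := by linarith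
  have hph : energyDensityTT' 1 0 U x = energyDensityTT' 1 0 U (2 - x) + U * (x - 1) := by
    rw [energyDensityTT'_zero, energyDensityTT'_zero]
    exact energyDensity2D_particleHole 1 hU hx0 hx2'
  have hch := energyDensityTT'_tp0_le_chord_below_one hU hnh huh hu₁ (x := 2 - x) (by linarith) (by linarith)
  rw [hph]
  have e1 : ((1 - (2 - x)) * uh + (2 - x - nh) * u₁) / (1 - nh) = ((x - 1) * uh + (2 - nh - x) * u₁) / (1 - nh) := by
    ring_nf
  linarith [hch, e1.symm.le, e1.le]

/-! ## §3 The kinetic ceiling on the segment at `(U, t′) = (8, 0)` from the three nodes -/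

/-- The #354 cap at (8, 7/8, 0) in `energyDensityTT'` form. [folklore] -/
theorem n7o8_U8_tp0_cap_of_r354 (h354 : cert_dbt299pair_allk) :
    energyDensityTT' 1 0 8 (7 / 8) ≤ (((-99352233445291 / 140737488355328) : ℚ) : ℝ) :=
  m3_tp0_upper_dbt299pair_allk_of h354

/-- **Kinetic CEILING on the filling segment `[99/100, 101/100]` at `(8, ·, 0)`** (conditional on #472 ∧ #354 ∧ #488; zero compute): for every
density `x` of the segment and every torus limit `ω` of unit `(rectN x L, S^z = 0)`-sector ground states of `hubbardTorusTT' L 1 0 8`,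
`−k(ω) ≤ 2504062787644156695299227/1888946593147858085478400 ≈ 1.3256398` — sharp `U`-chord with `U₁ = 6`: cap `e(8, x)` by the density chord of
#354 (at 7/8) and #472 (at 1) below half filling / its particle–hole image above; floor `e(6, x) ≥ lo₄₈₈ + 3(x − 1)` (tangent); the bound
`3·cap − 4·floor` is affine on each half with its worst value at the two ends (particle–hole symmetric). [cite: KomaTasaki1994, §1] -/
theorem n1seg_U8_tp0_negKinetic_le_of_r472_r354_r488 (h472 : cert_r472_pb2_tl_upper_n1_U8) (h354 : cert_dbt299pair_allk)
    (h488 : cert_r488_hubSQ_hanK7R6_U6_r5_e4_so4blk) {x : ℝ} (hx : x ∈ Set.Icc (99 / 100 : ℝ) (101 / 100)) :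
    ∀ (ω : InfVolFermionState 2) (Ls : ℕ → ℕ) (ψ : ∀ L, Fock (Orb (FermionTorus 2 L))),
      Tendsto Ls atTop atTop →
      (∀ j, IsGroundStateInSector (hubbardTorusTT' (Ls j) 1 0 8) (rectN x (Ls j)) 0 (ψ (Ls j))) →
      (∀ j, star (ψ (Ls j)) ⬝ᵥ ψ (Ls j) = 1) → ω.IsTorusLimitOf ψ Ls →
      -(∑ i : Fin 2, -(1 : ℝ) * ∑ σ : Fin 2,
          ((ω.expect {0, 0 + unitVec i}
              ((cAt 0 (mem_insert_self _ _) σ)ᴴ * cAt (0 + unitVec i) (mem_insert_of_mem (mem_singleton_self _)) σ)).re +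
            (ω.expect {0, 0 + unitVec i}
              ((cAt (0 + unitVec i) (mem_insert_of_mem (mem_singleton_self _)) σ)ᴴ * cAt 0 (mem_insert_self _ _) σ)).re)) ≤
        (2504062787644156695299227 / 1888946593147858085478400 : ℝ) := by
  intro ω Ls ψ hLs hψ h1 hω
  obtain ⟨hx1, hx2⟩ := hx
  have hcap1 := ctlTwin_cap_of_r472 h472
  have hcap78 := n7o8_U8_tp0_cap_of_r354 h354
  have hflo6 := n1_U6_tp0_floor_of_r488 h488
  push_cast at hcap1 hcap78 hflo6
  -- the floor at `U₁ = 6`, transported along the density by the half-filling tangent (slope 3)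
  have hF : energyDensityTT' 1 0 6 1 + 6 / 2 * (x - 1) ≤ energyDensityTT' 1 0 6 x :=
    energyDensityTT'_tp0_ge_halfFilling_tangent (by norm_num) (by linarith) (by linarith)
  have hF' : (-209996260256109312061651 / 302231454903657293676544 : ℝ) + 3 * (x - 1) ≤ energyDensityTT' 1 0 6 x := by
    linarith
  rcases le_total x 1 with hle | hge
  · -- below half filling: chord cap of #354 (at 7/8) and #472 (at 1)
    have hC := energyDensityTT'_tp0_le_chord_below_one (U := 8) (by norm_num) (nh := 7 / 8) (by norm_num) hcap78 hcap1
      (x := x) (by linarith) hle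
    have hk := torusLimit_negKinetic_le_uchord_real (U := 8) (U₁ := 6) (n := x) (by norm_num) (by norm_num) (by linarith)
      (by linarith) hC hF' ω Ls ψ hLs hψ h1 hω
    refine hk.trans ?_
    rw [div_le_iff₀ (by norm_num : (0 : ℝ) < 8 - 6)]
    have h18 : (1 : ℝ) - 7 / 8 = 1 / 8 := by norm_num
    rw [h18] at hC ⊢
    nlinarith [hx1, hle]
  · -- above half filling: particle–hole image of the same chord
    have hC := energyDensityTT'_tp0_le_chord_above_one (U := 8) (by norm_num) (nh := 7 / 8) (by norm_num) hcap78 hcap1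
      (x := x) hge (by linarith)
    have hk := torusLimit_negKinetic_le_uchord_real (U := 8) (U₁ := 6) (n := x) (by norm_num) (by norm_num) (by linarith)
      (by linarith) hC hF' ω Ls ψ hLs hψ h1 hω
    refine hk.trans ?_
    rw [div_le_iff₀ (by norm_num : (0 : ℝ) < 8 - 6)]
    have h18 : (1 : ℝ) - 7 / 8 = 1 / 8 := by norm_num
    rw [h18] at hC ⊢
    nlinarith [hx2, hge]

/-- **The wider segment `[49/50, 51/50]`**: `−k(ω) ≤ 2641350987214121229108379/1888946593147858085478400 ≈ 1.3983196` for every density of the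
segment and every torus-limit ground state at `(8, x, 0)` (same route). [cite: KomaTasaki1994, §1] -/
theorem n1seg2_U8_tp0_negKinetic_le_of_r472_r354_r488 (h472 : cert_r472_pb2_tl_upper_n1_U8) (h354 : cert_dbt299pair_allk)
    (h488 : cert_r488_hubSQ_hanK7R6_U6_r5_e4_so4blk) {x : ℝ} (hx : x ∈ Set.Icc (49 / 50 : ℝ) (51 / 50)) :
    ∀ (ω : InfVolFermionState 2) (Ls : ℕ → ℕ) (ψ : ∀ L, Fock (Orb (FermionTorus 2 L))),
      Tendsto Ls atTop atTop →
      (∀ j, IsGroundStateInSector (hubbardTorusTT' (Ls j) 1 0 8) (rectN x (Ls j)) 0 (ψ (Ls j))) →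
      (∀ j, star (ψ (Ls j)) ⬝ᵥ ψ (Ls j) = 1) → ω.IsTorusLimitOf ψ Ls →
      -(∑ i : Fin 2, -(1 : ℝ) * ∑ σ : Fin 2,
          ((ω.expect {0, 0 + unitVec i}
              ((cAt 0 (mem_insert_self _ _) σ)ᴴ * cAt (0 + unitVec i) (mem_insert_of_mem (mem_singleton_self _)) σ)).re +
            (ω.expect {0, 0 + unitVec i}
              ((cAt (0 + unitVec i) (mem_insert_of_mem (mem_singleton_self _)) σ)ᴴ * cAt 0 (mem_insert_self _ _) σ)).re)) ≤
        (2641350987214121229108379 / 1888946593147858085478400 : ℝ) := by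
  intro ω Ls ψ hLs hψ h1 hω
  obtain ⟨hx1, hx2⟩ := hx
  have hcap1 := ctlTwin_cap_of_r472 h472
  have hcap78 := n7o8_U8_tp0_cap_of_r354 h354
  have hflo6 := n1_U6_tp0_floor_of_r488 h488
  push_cast at hcap1 hcap78 hflo6
  have hF : energyDensityTT' 1 0 6 1 + 6 / 2 * (x - 1) ≤ energyDensityTT' 1 0 6 x :=
    energyDensityTT'_tp0_ge_halfFilling_tangent (by norm_num) (by linarith) (by linarith)
  have hF' : (-209996260256109312061651 / 302231454903657293676544 : ℝ) + 3 * (x - 1) ≤ energyDensityTT' 1 0 6 x := by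
    linarith
  rcases le_total x 1 with hle | hge
  · have hC := energyDensityTT'_tp0_le_chord_below_one (U := 8) (by norm_num) (nh := 7 / 8) (by norm_num) hcap78 hcap1
      (x := x) (by linarith) hle
    have hk := torusLimit_negKinetic_le_uchord_real (U := 8) (U₁ := 6) (n := x) (by norm_num) (by norm_num) (by linarith)
      (by linarith) hC hF' ω Ls ψ hLs hψ h1 hω
    refine hk.trans ?_
    rw [div_le_iff₀ (by norm_num : (0 : ℝ) < 8 - 6)]
    have h18 : (1 : ℝ) - 7 / 8 = 1 / 8 := by norm_num
    rw [h18] at hC ⊢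
    nlinarith [hx1, hle]
  · have hC := energyDensityTT'_tp0_le_chord_above_one (U := 8) (by norm_num) (nh := 7 / 8) (by norm_num) hcap78 hcap1
      (x := x) hge (by linarith)
    have hk := torusLimit_negKinetic_le_uchord_real (U := 8) (U₁ := 6) (n := x) (by norm_num) (by norm_num) (by linarith)
      (by linarith) hC hF' ω Ls ψ hLs hψ h1 hω
    refine hk.trans ?_
    rw [div_le_iff₀ (by norm_num : (0 : ℝ) < 8 - 6)]
    have h18 : (1 : ℝ) - 7 / 8 = 1 / 8 := by norm_num
    rw [h18] at hC ⊢
    nlinarith [hx2, hge]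

/-! ## §4 The stiffness leaves on the rectangle `U ≥ 8 × [n₁, n₂]` -/

/-- **Certified f-sum STIFFNESS CEILING on the rectangle `U ≥ 8 × [0.99, 1.01]` at `t′ = 0`** (conditional on #472 ∧ #354 ∧ #488 BY NAME; zero new solve):
for every `U ≥ 8` and every density `x ∈ [99/100, 101/100]`, `ObsStiffnessSeqCeilingAt 0 U x 0.33141` — for every sequence of torus sides `L_j → ∞`
and every `ρ_s > 0, θ₀ > 0` with `ρ_s·θ² ≤ E_{L_j}(θ) − E_{L_j}(0)` (`|θ| ≤ θ₀`) in the `(rectN x L, S^z = 0)` sectors of `hubbardTorusTT' L 1 0 U`: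
**`ρ_s ≤ 0.33141`** (tree units, `t = 1`; HVR `D_s ≤ 0.165705`; vs `0.3132401` at `(8, 1, 0)` and the premise-free `0.4052848`): §3 at every density of
the segment, then the Griffiths `U`-ray (`−k` non-increasing in `U` on the torus-limit ground-state classes). One-sided ceiling; print `ρ_s(·, 1, 0) = 0`.
[cite: ScalapinoWhiteZhang1993, §II] [cite: Griffiths1966, §II] -/
theorem n1seg_U8ray_tp0_stiffnessSeqLeaf_of_r472_r354_r488 (h472 : cert_r472_pb2_tl_upper_n1_U8) (h354 : cert_dbt299pair_allk)
    (h488 : cert_r488_hubSQ_hanK7R6_U6_r5_e4_so4blk) :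
    ∀ U : ℝ, 8 ≤ U → ∀ x ∈ Set.Icc (99 / 100 : ℝ) (101 / 100), ObsStiffnessSeqCeilingAt 0 U x (33141 / 100000) := by
  intro U hU x hx
  exact ObsStiffnessSeqCeilingAt_tp0_on_ray_of_forall_negKinetic_le (U₀ := 8) (by norm_num) hU (by linarith [hx.1])
    (by linarith [hx.2]) (n1seg_U8_tp0_negKinetic_le_of_r472_r354_r488 h472 h354 h488 hx) _ (by push_cast; norm_num)

/-- **The wider rectangle `U ≥ 8 × [0.98, 1.02]`**: `ObsStiffnessSeqCeilingAt 0 U x 0.3495799` (same route, same three nodes). [cite: ScalapinoWhiteZhang1993, §II] -/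
theorem n1seg2_U8ray_tp0_stiffnessSeqLeaf_of_r472_r354_r488 (h472 : cert_r472_pb2_tl_upper_n1_U8) (h354 : cert_dbt299pair_allk)
    (h488 : cert_r488_hubSQ_hanK7R6_U6_r5_e4_so4blk) :
    ∀ U : ℝ, 8 ≤ U → ∀ x ∈ Set.Icc (49 / 50 : ℝ) (51 / 50), ObsStiffnessSeqCeilingAt 0 U x (3495799 / 10000000) := by
  intro U hU x hx
  exact ObsStiffnessSeqCeilingAt_tp0_on_ray_of_forall_negKinetic_le (U₀ := 8) (by norm_num) hU (by linarith [hx.1])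
    (by linarith [hx.2]) (n1seg2_U8_tp0_negKinetic_le_of_r472_r354_r488 h472 h354 h488 hx) _ (by push_cast; norm_num)

/-- Literals (decidable): the two kinetic ceilings over 4 sit below the two leaf constants, and both leaf constants sit below the premise-free
kinematic bar `4052848/10⁷` and above the point value `0.3132401`. [folklore] -/
theorem n1seg_literals :
    (2504062787644156695299227 / 1888946593147858085478400 : ℚ) / 4 ≤ 33141 / 100000 ∧
      (2641350987214121229108379 / 1888946593147858085478400 : ℚ) / 4 ≤ 3495799 / 10000000 ∧
      (33141 / 100000 : ℚ) < 3495799 / 10000000 ∧ (3495799 / 10000000 : ℚ) < 4052848 / 10000000 ∧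
      (3132401 / 10000000 : ℚ) < 33141 / 100000 := by
  norm_num

end Summit.Ventures.CertifiedManyBodySolver.Certificates

end
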